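import Summits.BirchSwinnertonDyer.Rank1Residual.O5.FlexNFCaseNKodairaCellsThree
import Summits.BirchSwinnertonDyer.Rank1Residual.O5.FlexNFCaseNTailThree
import Summits.BirchSwinnertonDyer.Rank1Residual.O5.FlexNormalFormCaseNValLaw
import HarnessLib

/-!
# O5 — T30.4 v2 `FlexNFCaseNKodairaValLawThree` PROVED AS TYPED (`_holds`): the Kodaira symbol and conductor exponent at `3`
# of every Case-N flex normal form `y² + 3b·xy + A₃y = x³` (`A₃ ≡ 1 (mod 3)`, `b³ ≠ A₃`) are `cellNAt b A₃ (v₃(b³ − A₃))`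
# (cell `b2b-bsdres`, team n1011, ROW T-FLEX-KOD FILE 3b / RESEAT-TRIGGER T5 (cc-typer-5 (c28) p334541); seat
#  `b2b-bsdres-n1011-p18` GEN 14; theorems only; nothing of the typer's files is edited)

HONEST FRAMING (cell `b2b-bsdres`, run/shared/lean/b2b/bsd-rank1-residual/, verbatim in every file): the
goal of the cell is to DELETE the COMBINATION-SHAPED residual classes of the Birch–Swinnerton-Dyer formula
for ALL analytic-rank `≤ 1` elliptic curves over `ℚ` — "full BSD formula for every rank `≤ 1` curve in
class `C`" assembled STRICTLY from published theorems — so that the rank-`≤ 1` remainder becomes exactly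
the CONSTRUCTION-SHAPED classes, which are TYPED (missing-input `Prop`s), NOT attempted. This is not
"finishing BSD". Lane CLASS-CLOSURE / O5 (O5 OPEN): research route; census output (P-K19) is EVIDENCE,
never a Literature fact; nothing is booked; no mark of `RESIDUAL-MAP.md` moves. This file: THEOREMS ONLY
(no definition, no named fact, no `@[conjecture]` node, no `sorry`; net named-fact debt `0`); a `_holds`
theorem for a conjecture node closes NO pair and moves NO mark.

## What is proved
* §1 `padicValInt` bookkeeping (`3ⁿ ∥ x ↔ v₃ x = n`), and `ord3_eq_padicValInt` (the v1 fuel-bounded order IS `v₃`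
  when `v₃ ≤` fuel);
* §2 `three_pow_dvd_cube_sub` (`3`-adic order of `b³ − A₃` by residue cell), `flexNFCaseNKodairaValLawThree_holds :
  FlexNFCaseNKodairaValLawThree` (assembly of FILE 3a's cells II / III / IV / I₀* and F3⁻'s `Iₙ*` tail at the TRUE
  valuation), and `flexNFCaseNKodairaLawThree_of_padicValInt_le` (the v1 node's conclusion on every pair with
  `v₃(b³ − A₃) ≤ 64` — the exact complement of the ERRATUM witness family).
[cite: SilvermanATAEC1994, IV.9.4 and IV.11.1]
-/

open scoped NumberField

open IsDedekindDomain Rat.HeightOneSpectrum WeierstrassCurve NumberField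
  Literature.NumberTheory.EllipticCurves Literature.NumberTheory.EllipticCurves.Rank1Residual
  Literature.NumberTheory.DiophantineGeometry
  Summit.BirchSwinnertonDyer.BirchSwinnertonDyer.Rank2Observatory.RootNumber
  Summit.BirchSwinnertonDyer.Rank1Residual Summit.BirchSwinnertonDyer.Rank1Residual.Additive

namespace Summit.BirchSwinnertonDyer.Rank1Residual.O5.FlexNormalForm

/-! ## §1 Small bookkeeping -/

/-- `3ⁿ ∥ x` gives `padicValInt 3 x = n`. [folklore] -/
theorem padicValInt_three_eq_of_pexact {x : ℤ} {n : ℕ} (hx : x ≠ 0) (h : (3 : ℤ) ^ n ∣ x)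
    (h' : ¬ (3 : ℤ) ^ (n + 1) ∣ x) : padicValInt 3 x = n := by
  have h1 : n ≤ padicValInt 3 x := by
    rcases (padicValInt_dvd_iff (p := 3) n x).mp (by exact_mod_cast h) with h0 | h0
    · exact absurd h0 hx
    · exact h0
  have h2 : ¬ n + 1 ≤ padicValInt 3 x := fun hle ↦
    h' (by exact_mod_cast (padicValInt_dvd_iff (p := 3) (n + 1) x).mpr (Or.inr hle))
  omega

/-- `3^{v₃ x} ∥ x` for `x ≠ 0`. [folklore] -/
theorem pexact_padicValInt_three {x : ℤ} (hx : x ≠ 0) :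
    (3 : ℤ) ^ padicValInt 3 x ∣ x ∧ ¬ (3 : ℤ) ^ (padicValInt 3 x + 1) ∣ x := by
  refine ⟨by exact_mod_cast (padicValInt_dvd_iff (p := 3) (padicValInt 3 x) x).mpr (Or.inr le_rfl),
    fun h ↦ ?_⟩
  rcases (padicValInt_dvd_iff (p := 3) (padicValInt 3 x + 1) x).mp (by exact_mod_cast h) with h0 | h0
  · exact hx h0
  · omega

/-- **The fuel-bounded `ord3` IS the `3`-adic valuation whenever the valuation fits in the fuel**:
`ord3 n x = v₃(x)` for `x ≠ 0` with `v₃(x) ≤ n`. [folklore] -/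
theorem ord3_eq_padicValInt : ∀ (n : ℕ) (x : ℤ), x ≠ 0 → padicValInt 3 x ≤ n →
    ord3 n x = padicValInt 3 x := by
  intro n
  induction n with
  | zero => intro x _ h; simp [ord3]; omega
  | succ n ih =>
    intro x hx h
    by_cases h3 : (3 : ℤ) ∣ x
    · obtain ⟨y, rfl⟩ := h3
      have hy : y ≠ 0 := by rintro rfl; simp at hx
      have hv : padicValInt 3 (3 * y) = padicValInt 3 y + 1 := by
        rw [mul_comm]; exact_mod_cast padicValInt_mul_eq_succ (p := 3) y hy
      have hstep : ord3 (n + 1) (3 * y) = ord3 n y + 1 := by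
        simp only [ord3]
        rw [if_pos ⟨hx, by omega⟩, Int.mul_ediv_cancel_left _ (by norm_num)]
      rw [hstep, hv, ih y hy (by omega)]
    · have hv : padicValInt 3 x = 0 := padicValInt.eq_zero_of_not_dvd h3
      have hstep : ord3 (n + 1) x = 0 := by
        simp only [ord3]
        rw [if_neg]
        rintro ⟨-, h0⟩
        exact h3 (Int.dvd_of_emod_eq_zero h0)
      rw [hstep, hv]

/-! ## §2 The law with the TRUE valuation (v2 node), and the v1 conclusion for `v₃ ≤ 64` -/

/-- `3`-adic orders of `b³ − A₃` by residue cell (`A₃ ≡ 1 (mod 3)`): `b ≡ 1`, `A₃ ≡ 1 (mod 9)` ⟹ `9 ∣ b³ − A₃`;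
`b ≡ 1`, `A₃ ≢ 1 (mod 9)` ⟹ `3 ∥ b³ − A₃`; `b ≢ 1 (mod 3)` ⟹ `3 ∤ b³ − A₃`. [folklore] -/
theorem three_pow_dvd_cube_sub (b A₃ : ℤ) (hA : A₃ % 3 = 1) :
    (b % 3 = 1 → A₃ % 9 = 1 → (3 : ℤ) ^ 2 ∣ b ^ 3 - A₃) ∧
    (b % 3 = 1 → A₃ % 9 ≠ 1 → (3 : ℤ) ^ 1 ∣ b ^ 3 - A₃ ∧ ¬ (3 : ℤ) ^ (1 + 1) ∣ b ^ 3 - A₃) ∧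
    (b % 3 ≠ 1 → (3 : ℤ) ^ 0 ∣ b ^ 3 - A₃ ∧ ¬ (3 : ℤ) ^ (0 + 1) ∣ b ^ 3 - A₃) := by
  obtain ⟨k, hk⟩ : ∃ k, b = 3 * k + b % 3 := ⟨b / 3, by omega⟩
  refine ⟨fun hb ha9 ↦ ?_, fun hb ha9 ↦ ?_, fun hb ↦ ⟨one_dvd _, ?_⟩⟩
  · rw [hb] at hk
    have hK : b ^ 3 - A₃ = 9 * (3 * k ^ 3 + 3 * k ^ 2 + k) + (1 - A₃) := by rw [hk]; ring
    rw [hK, show ((3 : ℤ) ^ 2) = 9 by norm_num]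
    exact (Int.dvd_add_right (dvd_mul_right 9 _)).mpr (by omega)
  · rw [hb] at hk
    have hK : b ^ 3 - A₃ = 9 * (3 * k ^ 3 + 3 * k ^ 2 + k) + (1 - A₃) := by rw [hk]; ring
    refine ⟨?_, fun h ↦ ?_⟩
    · rw [hK, pow_one]
      exact (Int.dvd_add_right ⟨3 * (3 * k ^ 3 + 3 * k ^ 2 + k), by ring⟩).mpr (by omega)
    · rw [hK, show ((3 : ℤ) ^ (1 + 1)) = 9 by norm_num] at h
      have := (Int.dvd_add_right (dvd_mul_right 9 _)).mp h
      omega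
  · rw [zero_add, pow_one]
    have hb' : b % 3 = 0 ∨ b % 3 = 2 := by omega
    rcases hb' with h0 | h2
    · rw [h0] at hk
      intro h
      have e : b ^ 3 - A₃ = 3 * (9 * k ^ 3) + (-A₃) := by rw [hk]; ring
      rw [e] at h
      have := (Int.dvd_add_right (dvd_mul_right 3 _)).mp h
      omega
    · rw [h2] at hk
      intro h
      have e : b ^ 3 - A₃ = 3 * (9 * k ^ 3 + 18 * k ^ 2 + 12 * k + 3) + (-A₃ - 1) := by rw [hk]; ring
      rw [e] at h
      have := (Int.dvd_add_right (dvd_mul_right 3 _)).mp h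
      omega

/-- Ogg's formula is the tree's DEFINITION of `conductorExponent`: reading `f₃` from a computed Kodaira
symbol and `ord₃ Δ_min`. [cite: SilvermanATAEC1994, IV.11.1] -/
private theorem condExp_of_pair {W : WeierstrassCurve ℚ} {T : KodairaSymbol} {n : ℕ}
    (h : W.kodairaSymbolAt (Additive.placeOf 3) = T ∧ W.ordMinimalDiscriminant (Additive.placeOf 3) = n) :
    W.conductorExponent (Additive.placeOf 3) = n + 1 - T.numComponents := by
  unfold WeierstrassCurve.conductorExponent WeierstrassCurve.numComponentsAt
  rw [h.1, h.2]

/-- **T30.4 v2 PROVED AS TYPED: `FlexNFCaseNKodairaValLawThree` holds** — the Kodaira symbol and the conductor exponent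
at `3` of `y² + 3b·xy + A₃y = x³` (`A₃ ≡ 1 (mod 3)`, `b³ ≠ A₃`) are those of `cellNAt b A₃ (v₃(b³ − A₃))`: cells II (FILE 3a,
`9 ∤ u`), III (`9 ∣ u`, `b ≢ 1`), IV (`9 ∥ b³ − A₃`), I₀* (`27 ∥`), and the `Iₙ*` tail (`3ʷ ∥`, `w ≥ 4`, F3⁻) read through
Ogg's formula (the tree's definition of `conductorExponent`). [cite: SilvermanATAEC1994, IV.9.4 and IV.11.1] -/
theorem flexNFCaseNKodairaValLawThree_holds : FlexNFCaseNKodairaValLawThree := by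
  intro b A₃ hA hne
  have hx : b ^ 3 - A₃ ≠ 0 := sub_ne_zero.mpr hne
  obtain ⟨h11, h1n, hn1⟩ := three_pow_dvd_cube_sub b A₃ hA
  by_cases hb : b % 3 = 1
  · by_cases ha9 : A₃ % 9 = 1
    · -- `w := v₃(b³ − A₃) ≥ 2`
      obtain ⟨hM, hM'⟩ := pexact_padicValInt_three hx
      have hw2 : 2 ≤ padicValInt 3 (b ^ 3 - A₃) := by
        by_contra hlt
        exact hM' ((pow_dvd_pow (3 : ℤ) (by omega : padicValInt 3 (b ^ 3 - A₃) + 1 ≤ 2)).trans (h11 hb ha9))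
      rcases Nat.lt_or_ge (padicValInt 3 (b ^ 3 - A₃)) 4 with hlt | hge
      · rcases (show padicValInt 3 (b ^ 3 - A₃) = 2 ∨ padicValInt 3 (b ^ 3 - A₃) = 3 by omega) with h2 | h3
        · rw [h2] at hM hM' ⊢
          have hp := kodairaSymbolAt_and_ord_nfQ_zero_IV b A₃ hA hb hM hM'
          have hc : (cellNAt b A₃ 2).kod = .IV ∧ (cellNAt b A₃ 2).f = 3 := by
            by_cases hm : (3 * b - 2 - A₃) / 9 % 3 = 1 <;>
              simp [cellNAt, hb, ha9, hm, oggF, KodairaSymbol.numComponents]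
          refine ⟨by rw [hp.1, hc.1], ?_⟩
          rw [condExp_of_pair hp, hc.2]; rfl
        · rw [h3] at hM hM' ⊢
          have hp := kodairaSymbolAt_and_ord_nfQ_zero_Istar_zero b A₃ hA hb hM hM'
          have hc : (cellNAt b A₃ 3).kod = .Istar 0 ∧ (cellNAt b A₃ 3).f = 2 := by
            simp [cellNAt, hb, ha9, oggF, KodairaSymbol.numComponents]
          refine ⟨by rw [hp.1, hc.1], ?_⟩
          rw [condExp_of_pair hp, hc.2]; rfl
      · obtain ⟨hK, -, hf⟩ := kodairaSymbolAt_and_ord_nfQ_zero_tail b A₃ hA hb hge hM hM'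
        have hw2' : padicValInt 3 (b ^ 3 - A₃) ≠ 2 := by omega
        have hw3' : padicValInt 3 (b ^ 3 - A₃) ≠ 3 := by omega
        have hc : (cellNAt b A₃ (padicValInt 3 (b ^ 3 - A₃))).kod = .Istar (padicValInt 3 (b ^ 3 - A₃) - 3) ∧ (cellNAt b A₃ (padicValInt 3 (b ^ 3 - A₃))).f = 2 := by
          simp [cellNAt, hb, ha9, hw2', hw3', oggF]
          omega
        exact ⟨by rw [hK, hc.1], by rw [hf, hc.2]⟩
    · -- `A₃ ≢ 1 (mod 9)`: type II, `v₃Δ = 4`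
      obtain ⟨hM, hM'⟩ := h1n hb ha9
      have hu : ¬ (9 : ℤ) ∣ A₃ - 3 * b + 2 := by omega
      have hp := kodairaSymbolAt_and_ord_nfQ_zero_II b A₃ hA hu (m := 1) le_rfl hM hM'
      have hc : (cellNAt b A₃ (padicValInt 3 (b ^ 3 - A₃))).kod = .II ∧ (cellNAt b A₃ (padicValInt 3 (b ^ 3 - A₃))).f = 4 := by
        simp [cellNAt, hb, ha9, oggF, KodairaSymbol.numComponents]
      refine ⟨by rw [hp.1, hc.1], ?_⟩
      rw [condExp_of_pair hp, hc.2]; rfl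
  · obtain ⟨hM, hM'⟩ := hn1 hb
    by_cases hIII : (b % 3 = 0 ∧ A₃ % 9 = 7) ∨ (b % 3 = 2 ∧ A₃ % 9 = 4)
    · have hu : (9 : ℤ) ∣ A₃ - 3 * b + 2 := by omega
      have hp := kodairaSymbolAt_and_ord_nfQ_zero_III b A₃ hA hb hu
      have hIII' : (3 ∣ b ∧ A₃ % 9 = 7) ∨ (b % 3 = 2 ∧ A₃ % 9 = 4) := by omega
      have hc : (cellNAt b A₃ (padicValInt 3 (b ^ 3 - A₃))).kod = .III ∧ (cellNAt b A₃ (padicValInt 3 (b ^ 3 - A₃))).f = 2 := by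
        simp [cellNAt, hb, hIII', oggF, KodairaSymbol.numComponents]
      refine ⟨by rw [hp.1, hc.1], ?_⟩
      rw [condExp_of_pair hp, hc.2]; rfl
    · have hu : ¬ (9 : ℤ) ∣ A₃ - 3 * b + 2 := by omega
      have hp := kodairaSymbolAt_and_ord_nfQ_zero_II b A₃ hA hu (m := 0) (by norm_num) hM hM'
      have hIII' : ¬((3 ∣ b ∧ A₃ % 9 = 7) ∨ (b % 3 = 2 ∧ A₃ % 9 = 4)) := by omega
      have hc : (cellNAt b A₃ (padicValInt 3 (b ^ 3 - A₃))).kod = .II ∧ (cellNAt b A₃ (padicValInt 3 (b ^ 3 - A₃))).f = 3 := by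
        simp [cellNAt, hb, hIII', oggF, KodairaSymbol.numComponents]
      refine ⟨by rw [hp.1, hc.1], ?_⟩
      rw [condExp_of_pair hp, hc.2]; rfl


/-- **T30.4 on every `(b, A₃)` whose `3`-adic order `v₃(b³ − A₃)` fits in the typer's fuel (`≤ 64`)**:
the typed conclusion of `FlexNFCaseNKodairaLawThree` holds (Tate's algorithm, this file and
`FlexNFCaseNKodairaCellsThree`; `ord3 64 = v₃` there by `ord3_eq_padicValInt`).  The complementary pairs
(`v₃(b³ − A₃) ≥ 65`) are exactly where the typed node fails (`not_flexNFCaseNKodairaLawThree`).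
[cite: SilvermanATAEC1994, IV.9.4 and IV.11.1] -/
theorem flexNFCaseNKodairaLawThree_of_padicValInt_le (b A₃ : ℤ) (hA : A₃ % 3 = 1) (hne : b ^ 3 ≠ A₃)
    (h64 : padicValInt 3 (b ^ 3 - A₃) ≤ 64) :
    (nfQ b A₃ 0).kodairaSymbolAt (Additive.placeOf 3) = (cellN b A₃).kod ∧
      (nfQ b A₃ 0).conductorExponent (Additive.placeOf 3) = (cellN b A₃).f := by
  have hx : b ^ 3 - A₃ ≠ 0 := sub_ne_zero.mpr hne
  obtain ⟨h11, h1n, hn1⟩ := three_pow_dvd_cube_sub b A₃ hA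
  by_cases hb : b % 3 = 1
  · by_cases ha9 : A₃ % 9 = 1
    · -- `w := v₃(b³ − A₃) ≥ 2`
      obtain ⟨hM, hM'⟩ := pexact_padicValInt_three hx
      have hw2 : 2 ≤ padicValInt 3 (b ^ 3 - A₃) := by
        by_contra hlt
        exact hM' ((pow_dvd_pow (3 : ℤ) (by omega : padicValInt 3 (b ^ 3 - A₃) + 1 ≤ 2)).trans (h11 hb ha9))
      have hord3 : ord3 64 (b ^ 3 - A₃) = padicValInt 3 (b ^ 3 - A₃) := ord3_eq_padicValInt 64 _ hx h64
      rcases Nat.lt_or_ge (padicValInt 3 (b ^ 3 - A₃)) 4 with hlt | hge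
      · rcases (show padicValInt 3 (b ^ 3 - A₃) = 2 ∨ padicValInt 3 (b ^ 3 - A₃) = 3 by omega) with h2 | h3
        · rw [h2] at hM hM' hord3
          have hp := kodairaSymbolAt_and_ord_nfQ_zero_IV b A₃ hA hb hM hM'
          have hc : (cellN b A₃).kod = .IV ∧ (cellN b A₃).f = 3 := by
            by_cases hm : (3 * b - 2 - A₃) / 9 % 3 = 1 <;>
              simp [cellN, hb, ha9, hord3, hm, oggF, KodairaSymbol.numComponents]
          refine ⟨by rw [hp.1, hc.1], ?_⟩
          rw [condExp_of_pair hp, hc.2]; rfl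
        · rw [h3] at hM hM' hord3
          have hp := kodairaSymbolAt_and_ord_nfQ_zero_Istar_zero b A₃ hA hb hM hM'
          have hc : (cellN b A₃).kod = .Istar 0 ∧ (cellN b A₃).f = 2 := by
            simp [cellN, hb, ha9, hord3, oggF, KodairaSymbol.numComponents]
          refine ⟨by rw [hp.1, hc.1], ?_⟩
          rw [condExp_of_pair hp, hc.2]; rfl
      · obtain ⟨hK, -, hf⟩ := kodairaSymbolAt_and_ord_nfQ_zero_tail b A₃ hA hb hge hM hM'
        have hw2' : padicValInt 3 (b ^ 3 - A₃) ≠ 2 := by omega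
        have hw3' : padicValInt 3 (b ^ 3 - A₃) ≠ 3 := by omega
        have hc : (cellN b A₃).kod = .Istar (padicValInt 3 (b ^ 3 - A₃) - 3) ∧ (cellN b A₃).f = 2 := by
          simp [cellN, hb, ha9, hord3, hw2', hw3', oggF]
          omega
        exact ⟨by rw [hK, hc.1], by rw [hf, hc.2]⟩
    · -- `A₃ ≢ 1 (mod 9)`: type II, `v₃Δ = 4`
      obtain ⟨hM, hM'⟩ := h1n hb ha9
      have hu : ¬ (9 : ℤ) ∣ A₃ - 3 * b + 2 := by omega
      have hp := kodairaSymbolAt_and_ord_nfQ_zero_II b A₃ hA hu (m := 1) le_rfl hM hM'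
      have hc : (cellN b A₃).kod = .II ∧ (cellN b A₃).f = 4 := by
        simp [cellN, hb, ha9, oggF, KodairaSymbol.numComponents]
      refine ⟨by rw [hp.1, hc.1], ?_⟩
      rw [condExp_of_pair hp, hc.2]; rfl
  · obtain ⟨hM, hM'⟩ := hn1 hb
    by_cases hIII : (b % 3 = 0 ∧ A₃ % 9 = 7) ∨ (b % 3 = 2 ∧ A₃ % 9 = 4)
    · have hu : (9 : ℤ) ∣ A₃ - 3 * b + 2 := by omega
      have hp := kodairaSymbolAt_and_ord_nfQ_zero_III b A₃ hA hb hu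
      have hIII' : (3 ∣ b ∧ A₃ % 9 = 7) ∨ (b % 3 = 2 ∧ A₃ % 9 = 4) := by omega
      have hc : (cellN b A₃).kod = .III ∧ (cellN b A₃).f = 2 := by
        simp [cellN, hb, hIII', oggF, KodairaSymbol.numComponents]
      refine ⟨by rw [hp.1, hc.1], ?_⟩
      rw [condExp_of_pair hp, hc.2]; rfl
    · have hu : ¬ (9 : ℤ) ∣ A₃ - 3 * b + 2 := by omega
      have hp := kodairaSymbolAt_and_ord_nfQ_zero_II b A₃ hA hu (m := 0) (by norm_num) hM hM'
      have hIII' : ¬((3 ∣ b ∧ A₃ % 9 = 7) ∨ (b % 3 = 2 ∧ A₃ % 9 = 4)) := by omega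
      have hc : (cellN b A₃).kod = .II ∧ (cellN b A₃).f = 3 := by
        simp [cellN, hb, hIII', oggF, KodairaSymbol.numComponents]
      refine ⟨by rw [hp.1, hc.1], ?_⟩
      rw [condExp_of_pair hp, hc.2]; rfl


end Summit.BirchSwinnertonDyer.Rank1Residual.O5.FlexNormalForm
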